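import Literature.AlgebraicGeometry.Hyperkaehler.LLVGenerationTransport
import Literature.AlgebraicTopology.SingularHomology.CupProductProofs
import Literature.AlgebraicTopology.SingularHomology.CohomologyOfPoint
import Mathlib.LinearAlgebra.TensorProduct.Basic
import HarnessLib

/-!
# The cross product `H*(Y) ⊗ H*(Z) → H*(P)`, `a ⊗ b ↦ p^* a ∪ q^* b`, on total cohomology (Hatcher §3.2)

Layer `Literature/AlgebraicGeometry/Hyperkaehler`; companion of `LLVGeneration` / `LLVGenerationTransport`
(carriers `totalCohomology R Y = ⨁ₖ Hᵏ(Y; R)`, `ofDegree`, `totalCup`, `totalPullback`, `degreeOperator`,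
`totalLefschetz`).  For a space `P` with two maps `p : P → Y`, `q : P → Z` (intended: `P = Y × Z`, or the complex
points `(Y ⊗ Z)(ℂ)` of a product of varieties with `p = fst(ℂ)`, `q = snd(ℂ)`), the **cross product**
(Hatcher §3.2 p. 210/218: "`a × b = p₁^*(a) ⌣ p₂^*(b)`", the map `H*(X; R) ⊗_R H*(Y; R) → H*(X × Y; R)` of the
Künneth theorem 3.16) assembled on TOTAL cohomology as ONE `R`-linear map
`totalCross R p q : H*(Y; R) ⊗ H*(Z; R) →ₗ H*(P; R)`, with the formal properties every consumer needs:

* `totalCross_tmul`, `totalCross_tmul_ofDegree` — `a ⊗ b ↦ p^* a ∪ q^* b`, homogeneous form;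
* `totalCup_assoc`, `totalCup_comm_ofDegree` — the ring structure of `H*` (associativity; graded commutativity
  `x ⌣ y = (-1)^{ij} y ⌣ x` from the tree's PROVED `cupProduct_gradedComm_holds`, Hatcher Thm. 3.11);
* **`totalCup_totalCross_tmul`** — the Koszul rule `(a × b)(a' × b') = (-1)^{|b||a'|} (a a') × (b b')` for homogeneous
  `b`, `a'` (Hatcher p. 218 "`(a × b)(c × d) = (-1)^{|b||c|} ac × bd`"), and its sign-free cases
  `totalCup_totalCross_tmul_one_left/right`;
* **`totalPullback_totalCross`** — naturality: if `p ∘ d = t ∘ p'`, `q ∘ d = τ ∘ q'` then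
  `d^*(a × b) = t^* a × τ^* b`;
* **`degreeOperator_comp_totalCross`**, **`totalLefschetz_comp_totalCross`** — the degree operator of "dimension"
  `N₁ + N₂` and the Lefschetz operator of `p^* x + q^* y` act on cross products as `h ⊗ 1 + 1 ⊗ h'` and
  `L_x ⊗ 1 + 1 ⊗ L_y` (the operators of Looijenga–Lunts' exterior tensor product `M' ⊠ M''`, §1 p. 4);
* **slices**: for `ι : Z → P` with `p ∘ ι` constant and `q ∘ ι = id`, `ι^*(a × b) = 0` for `a` of positive degree
  and `ι^*((c·1) × b) = c·b` (`totalPullback_slice_totalCross_*`); symmetrically for `Y`.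

Everything is formal (proved; no named fact, no instance, no `sorry`); no Künneth ISOMORPHISM is asserted here — that
is the sequel `HodgeTheory/TotalCohomologyKunneth` for smooth projective varieties.  Written for cell `hodge-kum4`
(lane (V), V0 `HilbertKummerTransfer`: Beauville's cover `A × Kⁿ(A) → A^[n+1]`).

References: A. Hatcher, *Algebraic Topology* (2002) §3.2, pp. 210–219 (cross product, Thm. 3.11, Thm. 3.16);
E. Looijenga, V. Lunts, Invent. Math. 129 (1997) §1 p. 4 (`M' ⊠ M''`, `e(m' ⊗ m'') = e m' ⊗ m'' + m' ⊗ e m''`).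
-/

noncomputable section

open DirectSum TensorProduct
open Literature.AlgebraicTopology.SingularHomology

universe u v

namespace Literature.AlgebraicGeometry.Hyperkaehler

variable {R : Type v} [CommRing R] {P Y Z : Type u} [TopologicalSpace P] [TopologicalSpace Y]
  [TopologicalSpace Z]

/-! ### The ring `H*(Y; R)`: unit, associativity and graded commutativity of `totalCup` -/

/-- Re-indexing a homogeneous product along equal degrees. [cite: HatcherAT2002, §3.2 p. 206] -/
theorem ofDegree_cupProduct_index {p q n m : ℕ} (h₁ : p + q = n) (h₂ : p + q = m)
    (x : singularCohomology R R Y p) (y : singularCohomology R R Y q) :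
    ofDegree R Y n (cupProduct h₁ x y) = ofDegree R Y m (cupProduct h₂ x y) := by
  subst h₁; subst h₂; rfl

/-- `x ⌣ 1 = x` on `H*(Y; R)`. [cite: HatcherAT2002, §3.2 p. 211] -/
theorem totalCup_one (x : totalCohomology R Y) :
    totalCup R Y x (ofDegree R Y 0 (singularCohomology.one R Y)) = x := by
  induction x using DirectSum.induction_on with
  | zero => rw [map_zero, LinearMap.zero_apply]
  | add x x' hx hx' => rw [map_add, LinearMap.add_apply, hx, hx']
  | of k x =>
    rw [← lof_eq_of R]
    change totalCup R Y (ofDegree R Y k x) _ = ofDegree R Y k x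
    rw [totalCup_lof]
    exact congrArg (ofDegree R Y k) (cupProduct_one x)

/-- `1 ⌣ x = x` on `H*(Y; R)`. [cite: HatcherAT2002, §3.2 p. 211] -/
theorem one_totalCup (x : totalCohomology R Y) :
    totalCup R Y (ofDegree R Y 0 (singularCohomology.one R Y)) x = x := by
  induction x using DirectSum.induction_on with
  | zero => rw [map_zero]
  | add x x' hx hx' => rw [map_add, hx, hx']
  | of k x =>
    rw [← lof_eq_of R]
    change totalCup R Y _ (ofDegree R Y k x) = ofDegree R Y k x
    rw [totalCup_lof]
    exact (ofDegree_cupProduct_index _ _ _ _).trans (congrArg (ofDegree R Y k) (one_cupProduct x))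

/-- **Associativity of the cup product on `H*(Y; R)`**: `(x ⌣ y) ⌣ z = x ⌣ (y ⌣ z)`.
[cite: HatcherAT2002, §3.2 p. 211] -/
theorem totalCup_assoc (x y z : totalCohomology R Y) :
    totalCup R Y (totalCup R Y x y) z = totalCup R Y x (totalCup R Y y z) := by
  induction x using DirectSum.induction_on with
  | zero => simp only [map_zero, LinearMap.zero_apply]
  | add x x' hx hx' => simp only [map_add, LinearMap.add_apply, hx, hx']
  | of p a =>
  induction y using DirectSum.induction_on with
  | zero => simp only [map_zero, LinearMap.zero_apply]
  | add y y' hy hy' => simp only [map_add, LinearMap.add_apply, hy, hy']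
  | of q b =>
  induction z using DirectSum.induction_on with
  | zero => simp only [map_zero]
  | add z z' hz hz' => simp only [map_add, hz, hz']
  | of r c =>
    simp only [← lof_eq_of R, totalCup_lof]
    rw [cupProduct_assoc rfl rfl rfl (Nat.add_assoc p q r).symm a b c]
    exact ofDegree_cupProduct_index _ _ _ _

/-- **Graded commutativity on `H*(Y; R)`** for homogeneous classes: `x ⌣ y = (-1)^{pq} y ⌣ x` (Hatcher Thm. 3.11,
the tree's proved `cupProduct_gradedComm_holds`). [cite: HatcherAT2002, §3.2 Thm. 3.11] -/
theorem totalCup_comm_ofDegree (p q : ℕ) (x : singularCohomology R R Y p) (y : singularCohomology R R Y q) :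
    totalCup R Y (ofDegree R Y p x) (ofDegree R Y q y) =
      ((-1 : R) ^ (p * q)) • totalCup R Y (ofDegree R Y q y) (ofDegree R Y p x) := by
  rw [totalCup_lof, totalCup_lof, cupProduct_gradedComm_holds R Y rfl (Nat.add_comm q p) x y, map_smul,
    ofDegree_cupProduct_index]

/-- Even classes are central: `x ⌣ y = y ⌣ x` if `x` has even degree. [cite: HatcherAT2002, §3.2 Thm. 3.11] -/
theorem totalCup_comm_ofDegree_of_even {p : ℕ} (hp : Even p) (x : singularCohomology R R Y p)
    (y : totalCohomology R Y) : totalCup R Y (ofDegree R Y p x) y = totalCup R Y y (ofDegree R Y p x) := by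
  induction y using DirectSum.induction_on with
  | zero => simp only [map_zero, LinearMap.zero_apply]
  | add y y' hy hy' => simp only [map_add, LinearMap.add_apply, hy, hy']
  | of q b =>
    rw [← lof_eq_of R]
    change totalCup R Y (ofDegree R Y p x) (ofDegree R Y q b) = totalCup R Y (ofDegree R Y q b) (ofDegree R Y p x)
    rw [totalCup_comm_ofDegree]
    obtain ⟨k, rfl⟩ := hp
    rw [show (k + k) * q = 2 * (k * q) by ring, pow_mul, neg_one_sq, one_pow, one_smul]

/-! ### The cross product -/

variable (R) in
/-- **The cross product on total cohomology**: `totalCross R p q (a ⊗ b) = p^* a ⌣ q^* b ∈ H*(P; R)` for maps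
`p : P → Y`, `q : P → Z` (Hatcher: "`a × b = p₁^*(a) ⌣ p₂^*(b)`"). [cite: HatcherAT2002, §3.2 p. 210 and Thm. 3.16] -/
def totalCross (p : C(P, Y)) (q : C(P, Z)) :
    totalCohomology R Y ⊗[R] totalCohomology R Z →ₗ[R] totalCohomology R P :=
  TensorProduct.lift ((totalCup R P ∘ₗ totalPullback R p).compl₂ (totalPullback R q))

variable (p : C(P, Y)) (q : C(P, Z))

/-- `(a ⊗ b) ↦ p^* a ⌣ q^* b`. [cite: HatcherAT2002, §3.2 p. 210] -/
@[simp]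
theorem totalCross_tmul (a : totalCohomology R Y) (b : totalCohomology R Z) :
    totalCross R p q (a ⊗ₜ[R] b) = totalCup R P (totalPullback R p a) (totalPullback R q b) := by
  simp only [totalCross, TensorProduct.lift.tmul, LinearMap.compl₂_apply, LinearMap.coe_comp, Function.comp_apply]

/-- Homogeneous form: `(x ∈ Hⁱ) ⊗ (y ∈ Hʲ) ↦ p^* x ⌣ q^* y ∈ H^{i+j}`. [cite: HatcherAT2002, §3.2 p. 210] -/
theorem totalCross_tmul_ofDegree (i j : ℕ) (x : singularCohomology R R Y i) (y : singularCohomology R R Z j) :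
    totalCross R p q (ofDegree R Y i x ⊗ₜ[R] ofDegree R Z j y) =
      ofDegree R P (i + j) (cupProduct rfl (singularCohomology.map R R p i x) (singularCohomology.map R R q j y)) := by
  rw [totalCross_tmul, totalPullback_lof, totalPullback_lof, totalCup_lof]

/-- `a × 1 = p^* a`. [cite: HatcherAT2002, §3.2 p. 210] -/
theorem totalCross_tmul_one (a : totalCohomology R Y) :
    totalCross R p q (a ⊗ₜ[R] ofDegree R Z 0 (singularCohomology.one R Z)) = totalPullback R p a := by
  rw [totalCross_tmul, totalPullback_lof, singularCohomology.map_one, totalCup_one]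

/-- `1 × b = q^* b`. [cite: HatcherAT2002, §3.2 p. 210] -/
theorem totalCross_one_tmul (b : totalCohomology R Z) :
    totalCross R p q (ofDegree R Y 0 (singularCohomology.one R Y) ⊗ₜ[R] b) = totalPullback R q b := by
  rw [totalCross_tmul, totalPullback_lof, singularCohomology.map_one, one_totalCup]

/-- The unit: `1 × 1 = 1`. [cite: HatcherAT2002, §3.2 p. 211] -/
theorem totalCross_one_tmul_one :
    totalCross R p q (ofDegree R Y 0 (singularCohomology.one R Y) ⊗ₜ[R] ofDegree R Z 0 (singularCohomology.one R Z)) =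
      ofDegree R P 0 (singularCohomology.one R P) := by
  rw [totalCross_one_tmul, totalPullback_lof, singularCohomology.map_one]

/-! ### The Koszul rule -/

/-- **`(a × b) ⌣ (a' × b') = (-1)^{|b||a'|} (a ⌣ a') × (b ⌣ b')`** for `b ∈ Hʲ(Z)`, `a' ∈ Hⁱ(Y)` homogeneous and
arbitrary `a`, `b'` (Hatcher: "`(a × b)(c × d) = (-1)^{|b||c|} ac × bd`"). [cite: HatcherAT2002, §3.2 p. 218 (proof of Thm. 3.16)] -/
theorem totalCup_totalCross_tmul (a : totalCohomology R Y) (j : ℕ) (b : singularCohomology R R Z j) (i : ℕ)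
    (a' : singularCohomology R R Y i) (b' : totalCohomology R Z) :
    totalCup R P (totalCross R p q (a ⊗ₜ[R] ofDegree R Z j b)) (totalCross R p q (ofDegree R Y i a' ⊗ₜ[R] b')) =
      ((-1 : R) ^ (i * j)) •
        totalCross R p q (totalCup R Y a (ofDegree R Y i a') ⊗ₜ[R] totalCup R Z (ofDegree R Z j b) b') := by
  simp only [totalCross_tmul, totalPullback_totalCup, totalPullback_lof]
  -- `(A ⌣ B) ⌣ (A' ⌣ B') = A ⌣ ((B ⌣ A') ⌣ B') = ± A ⌣ ((A' ⌣ B) ⌣ B') = ± (A ⌣ A') ⌣ (B ⌣ B')`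
  set A := totalPullback R p a
  set B' := totalPullback R q b'
  rw [totalCup_assoc, ← totalCup_assoc (ofDegree R P j _), totalCup_comm_ofDegree j i, LinearMap.map_smul₂,
    map_smul, totalCup_assoc (ofDegree R P i _), ← totalCup_assoc A, mul_comm j i]

/-- **`(1 × y) ⌣ (a × b) = a × (y ⌣ b)` for `y` of EVEN degree** (no sign). [cite: HatcherAT2002, §3.2 p. 218] -/
theorem totalCup_totalCross_one_tmul_of_even {j : ℕ} (hj : Even j) (y : singularCohomology R R Z j)
    (a : totalCohomology R Y) (b : totalCohomology R Z) :
    totalCup R P (totalCross R p q (ofDegree R Y 0 (singularCohomology.one R Y) ⊗ₜ[R] ofDegree R Z j y))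
        (totalCross R p q (a ⊗ₜ[R] b)) =
      totalCross R p q (a ⊗ₜ[R] totalCup R Z (ofDegree R Z j y) b) := by
  induction a using DirectSum.induction_on with
  | zero => simp only [zero_tmul, map_zero]
  | add x x' hx hx' => simp only [add_tmul, map_add, hx, hx']
  | of i x =>
    rw [← lof_eq_of R]
    change totalCup R P _ (totalCross R p q (ofDegree R Y i x ⊗ₜ[R] b)) =
      totalCross R p q (ofDegree R Y i x ⊗ₜ[R] _)
    rw [totalCup_totalCross_tmul, one_totalCup]
    obtain ⟨k, rfl⟩ := hj
    rw [show i * (k + k) = 2 * (i * k) by ring, pow_mul, neg_one_sq, one_pow, one_smul]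

/-- Sign-free case: `(a × b) ⌣ (1 × b') = a × (b ⌣ b')`. [cite: HatcherAT2002, §3.2 p. 218] -/
theorem totalCup_totalCross_tmul_one_left (a : totalCohomology R Y) (b b' : totalCohomology R Z) :
    totalCup R P (totalCross R p q (a ⊗ₜ[R] b))
        (totalCross R p q (ofDegree R Y 0 (singularCohomology.one R Y) ⊗ₜ[R] b')) =
      totalCross R p q (a ⊗ₜ[R] totalCup R Z b b') := by
  induction b using DirectSum.induction_on with
  | zero => simp only [tmul_zero, map_zero, LinearMap.zero_apply]
  | add y y' hy hy' => simp only [tmul_add, map_add, LinearMap.add_apply, hy, hy']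
  | of j b =>
    rw [← lof_eq_of R]
    change totalCup R P (totalCross R p q (a ⊗ₜ[R] ofDegree R Z j b)) _ =
      totalCross R p q (a ⊗ₜ[R] totalCup R Z (ofDegree R Z j b) b')
    rw [totalCup_totalCross_tmul, zero_mul, pow_zero, one_smul, totalCup_one]

/-- Sign-free case: `(a × 1) ⌣ (a' × b') = (a ⌣ a') × b'`. [cite: HatcherAT2002, §3.2 p. 218] -/
theorem totalCup_totalCross_tmul_one_right (a a' : totalCohomology R Y) (b' : totalCohomology R Z) :
    totalCup R P (totalCross R p q (a ⊗ₜ[R] ofDegree R Z 0 (singularCohomology.one R Z)))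
        (totalCross R p q (a' ⊗ₜ[R] b')) =
      totalCross R p q (totalCup R Y a a' ⊗ₜ[R] b') := by
  induction a' using DirectSum.induction_on with
  | zero => simp only [zero_tmul, map_zero]
  | add y y' hy hy' => simp only [add_tmul, map_add, hy, hy']
  | of i a' =>
    rw [← lof_eq_of R]
    change totalCup R P _ (totalCross R p q (ofDegree R Y i a' ⊗ₜ[R] b')) =
      totalCross R p q (totalCup R Y a (ofDegree R Y i a') ⊗ₜ[R] b')
    rw [totalCup_totalCross_tmul, mul_zero, pow_zero, one_smul, one_totalCup]

/-- `(1 × b) ⌣ (1 × b') = 1 × (b ⌣ b')`: `b ↦ 1 × b = q^* b` is multiplicative. [cite: HatcherAT2002, §3.2 p. 218] -/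
theorem totalCup_totalCross_one_tmul (b b' : totalCohomology R Z) :
    totalCup R P (totalCross R p q (ofDegree R Y 0 (singularCohomology.one R Y) ⊗ₜ[R] b))
        (totalCross R p q (ofDegree R Y 0 (singularCohomology.one R Y) ⊗ₜ[R] b')) =
      totalCross R p q (ofDegree R Y 0 (singularCohomology.one R Y) ⊗ₜ[R] totalCup R Z b b') :=
  totalCup_totalCross_tmul_one_left p q _ b b'

/-- `(a × 1) ⌣ (a' × 1) = (a ⌣ a') × 1`: `a ↦ a × 1 = p^* a` is multiplicative. [cite: HatcherAT2002, §3.2 p. 218] -/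
theorem totalCup_totalCross_tmul_one (a a' : totalCohomology R Y) :
    totalCup R P (totalCross R p q (a ⊗ₜ[R] ofDegree R Z 0 (singularCohomology.one R Z)))
        (totalCross R p q (a' ⊗ₜ[R] ofDegree R Z 0 (singularCohomology.one R Z))) =
      totalCross R p q (totalCup R Y a a' ⊗ₜ[R] ofDegree R Z 0 (singularCohomology.one R Z)) :=
  totalCup_totalCross_tmul_one_right p q a a' _

/-- `(a × 1) ⌣ (1 × b) = a × b`. [cite: HatcherAT2002, §3.2 p. 218] -/
theorem totalCup_totalCross_tmul_one_one_tmul (a : totalCohomology R Y) (b : totalCohomology R Z) :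
    totalCup R P (totalCross R p q (a ⊗ₜ[R] ofDegree R Z 0 (singularCohomology.one R Z)))
        (totalCross R p q (ofDegree R Y 0 (singularCohomology.one R Y) ⊗ₜ[R] b)) =
      totalCross R p q (a ⊗ₜ[R] b) := by
  rw [totalCup_totalCross_tmul_one_right, totalCup_one]

/-! ### Naturality -/

/-- **Naturality of the cross product**: for maps `d : P₁ → P`, `t : Y₁ → Y`, `τ : Z₁ → Z` with `p ∘ d = t ∘ p₁` and
`q ∘ d = τ ∘ q₁` (projections `p₁ : P₁ → Y₁`, `q₁ : P₁ → Z₁`): `d^*(a × b) = (t^* a) × (τ^* b)`.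
[cite: HatcherAT2002, §3.2 p. 210 (naturality of ×)] -/
theorem totalPullback_totalCross {P₁ Y₁ Z₁ : Type u} [TopologicalSpace P₁] [TopologicalSpace Y₁] [TopologicalSpace Z₁]
    (p₁ : C(P₁, Y₁)) (q₁ : C(P₁, Z₁)) (d : C(P₁, P)) (t : C(Y₁, Y)) (τ : C(Z₁, Z)) (hp : p.comp d = t.comp p₁)
    (hq : q.comp d = τ.comp q₁) (x : totalCohomology R Y ⊗[R] totalCohomology R Z) :
    totalPullback R d (totalCross R p q x) =
      totalCross R p₁ q₁ (TensorProduct.map (totalPullback R t) (totalPullback R τ) x) := by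
  induction x using TensorProduct.induction_on with
  | zero => simp only [map_zero]
  | add x y hx hy => simp only [map_add, hx, hy]
  | tmul a b =>
    have ha : totalPullback R d (totalPullback R p a) = totalPullback R p₁ (totalPullback R t a) := by
      rw [← LinearMap.comp_apply, ← totalPullback_comp, hp, totalPullback_comp, LinearMap.comp_apply]
    have hb : totalPullback R d (totalPullback R q b) = totalPullback R q₁ (totalPullback R τ b) := by
      rw [← LinearMap.comp_apply, ← totalPullback_comp, hq, totalPullback_comp, LinearMap.comp_apply]
    rw [TensorProduct.map_tmul, totalCross_tmul, totalCross_tmul, totalPullback_totalCup, ha, hb]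

/-- Special case: a self-map `d` of `P` commuting with both projections up to self-maps `t`, `τ` of the factors
(a "product map"). [cite: HatcherAT2002, §3.2 p. 210] -/
theorem totalPullback_totalCross_self (d : C(P, P)) (t : C(Y, Y)) (τ : C(Z, Z)) (hp : p.comp d = t.comp p)
    (hq : q.comp d = τ.comp q) (x : totalCohomology R Y ⊗[R] totalCohomology R Z) :
    totalPullback R d (totalCross R p q x) =
      totalCross R p q (TensorProduct.map (totalPullback R t) (totalPullback R τ) x) :=
  totalPullback_totalCross p q p q d t τ hp hq x

/-! ### The degree operator and the Lefschetz operators on cross products -/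

/-- **Degrees add**: `h_{N₁+N₂} (a × b) = (h_{N₁} a) × b + a × (h_{N₂} b)`, i.e.
`h_P ∘ × = × ∘ (h_Y ⊗ 1 + 1 ⊗ h_Z)`. [cite: LooijengaLunts1997, §1 p. 4 (M' ⊠ M'')] -/
theorem degreeOperator_comp_totalCross (N₁ N₂ : ℕ) :
    degreeOperator R P (N₁ + N₂) ∘ₗ totalCross R p q =
      totalCross R p q ∘ₗ ((degreeOperator R Y N₁).rTensor (totalCohomology R Z) +
        (degreeOperator R Z N₂).lTensor (totalCohomology R Y)) := by
  refine TensorProduct.ext' fun a b ↦ ?_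
  simp only [LinearMap.coe_comp, Function.comp_apply, LinearMap.add_apply, LinearMap.rTensor_tmul,
    LinearMap.lTensor_tmul, map_add]
  induction a using DirectSum.induction_on with
  | zero => simp only [zero_tmul, map_zero, add_zero]
  | add x x' hx hx' =>
    simp only [add_tmul, map_add] at hx hx' ⊢
    rw [hx, hx']; abel
  | of i x =>
  induction b using DirectSum.induction_on with
  | zero => simp only [tmul_zero, map_zero, add_zero]
  | add y y' hy hy' =>
    simp only [tmul_add, map_add] at hy hy' ⊢
    rw [hy, hy']; abel
  | of j y =>
    simp only [← lof_eq_of R, degreeOperator_lof, map_smul, smul_tmul, tmul_smul, totalCross_tmul_ofDegree]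
    rw [← add_smul]
    congr 1
    push_cast
    ring

/-- Applied form of `degreeOperator_comp_totalCross`. [cite: LooijengaLunts1997, §1 p. 4 (M' ⊠ M'')] -/
theorem degreeOperator_totalCross (N₁ N₂ : ℕ) (x : totalCohomology R Y ⊗[R] totalCohomology R Z) :
    degreeOperator R P (N₁ + N₂) (totalCross R p q x) =
      totalCross R p q (((degreeOperator R Y N₁).rTensor (totalCohomology R Z) +
        (degreeOperator R Z N₂).lTensor (totalCohomology R Y)) x) :=
  LinearMap.congr_fun (degreeOperator_comp_totalCross p q N₁ N₂) x

/-- **The Lefschetz operator of a split class**: for `x ∈ H²(Y)`, `y ∈ H²(Z)`,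
`L_{p^*x + q^*y} (a × b) = (L_x a) × b + a × (L_y b)`, i.e. `L ∘ × = × ∘ (L_x ⊗ 1 + 1 ⊗ L_y)` (the even class
`1 × y` commutes past `a × 1`). [cite: LooijengaLunts1997, §1 p. 4 ("e_{(a',a'')}(m' ⊗ m'') = e_{a'} m' ⊗ m'' + m' ⊗ e_{a''} m''")] -/
theorem totalLefschetz_comp_totalCross (x : singularCohomology R R Y 2) (y : singularCohomology R R Z 2) :
    totalLefschetz (singularCohomology.map R R p 2 x + singularCohomology.map R R q 2 y) ∘ₗ totalCross R p q =
      totalCross R p q ∘ₗ ((totalLefschetz x).rTensor (totalCohomology R Z) +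
        (totalLefschetz y).lTensor (totalCohomology R Y)) := by
  refine TensorProduct.ext' fun a b ↦ ?_
  simp only [LinearMap.coe_comp, Function.comp_apply, LinearMap.add_apply, LinearMap.rTensor_tmul,
    LinearMap.lTensor_tmul, map_add, totalLefschetz_eq_totalCup]
  have h1 : ofDegree R P 2 (singularCohomology.map R R p 2 x) =
      totalCross R p q (ofDegree R Y 2 x ⊗ₜ[R] ofDegree R Z 0 (singularCohomology.one R Z)) := by
    rw [totalCross_tmul_one, totalPullback_lof]
  have h2 : ofDegree R P 2 (singularCohomology.map R R q 2 y) =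
      totalCross R p q (ofDegree R Y 0 (singularCohomology.one R Y) ⊗ₜ[R] ofDegree R Z 2 y) := by
    rw [totalCross_one_tmul, totalPullback_lof]
  rw [h1, h2, totalCup_totalCross_tmul_one_right, totalCup_totalCross_one_tmul_of_even p q even_two]

/-- Applied form of `totalLefschetz_comp_totalCross`. [cite: LooijengaLunts1997, §1 p. 4] -/
theorem totalLefschetz_totalCross (x : singularCohomology R R Y 2) (y : singularCohomology R R Z 2)
    (v : totalCohomology R Y ⊗[R] totalCohomology R Z) :
    totalLefschetz (singularCohomology.map R R p 2 x + singularCohomology.map R R q 2 y) (totalCross R p q v) =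
      totalCross R p q (((totalLefschetz x).rTensor (totalCohomology R Z) +
        (totalLefschetz y).lTensor (totalCohomology R Y)) v) :=
  LinearMap.congr_fun (totalLefschetz_comp_totalCross p q x y) v

/-! ### Slices -/

/-- A constant map kills cohomology of positive degree: `(const y₀)^* = 0` on `Hⁱ(Y)`, `i ≠ 0` (it factors through
`Hⁱ(pt) = 0`). [cite: HatcherAT2002, §3.1 p. 199 (dimension axiom)] -/
theorem singularCohomology_map_const {i : ℕ} (hi : i ≠ 0) (y₀ : Y) (a : singularCohomology R R Y i) :
    singularCohomology.map R R (ContinuousMap.const Z y₀) i a = 0 := by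
  have hfac : (ContinuousMap.const Z y₀ : C(Z, Y)) =
      (ContinuousMap.const PUnit.{u + 1} y₀ : C(PUnit, Y)).comp (ContinuousMap.const Z PUnit.unit) := by
    ext; rfl
  rw [hfac, singularCohomology.map_comp, ModuleCat.comp_apply]
  have h0 : singularCohomology.map R R (ContinuousMap.const PUnit.{u + 1} y₀ : C(PUnit, Y)) i a = 0 := by
    haveI := ModuleCat.subsingleton_of_isZero
      (singularCochainComplex.isZero_singularCohomology_of_subsingleton' (R := R) (M := R) (X := PUnit.{u + 1}) hi)
    exact Subsingleton.elim _ _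
  rw [h0, map_zero]

/-- **Slice `ι : Z → P` with `p ∘ ι` constant: positive degrees of `Y` die** —
`ι^*((a ∈ Hⁱ(Y), i ≠ 0) × b) = 0`. [cite: HatcherAT2002, §3.2 p. 210] -/
theorem totalPullback_slice_totalCross_of_ne_zero (ι : C(Z, P)) (y₀ : Y) (hp : p.comp ι = ContinuousMap.const Z y₀)
    {i : ℕ} (hi : i ≠ 0) (a : singularCohomology R R Y i) (b : totalCohomology R Z) :
    totalPullback R ι (totalCross R p q (ofDegree R Y i a ⊗ₜ[R] b)) = 0 := by
  have ha : totalPullback R ι (totalPullback R p (ofDegree R Y i a)) = 0 := by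
    rw [← LinearMap.comp_apply, ← totalPullback_comp, hp, totalPullback_lof, singularCohomology_map_const hi,
      map_zero]
  rw [totalCross_tmul, totalPullback_totalCup, ha, map_zero, LinearMap.zero_apply]

/-- **Slice `ι : Z → P` with `p ∘ ι` constant and `q ∘ ι = id`: `ι^*(1 × b) = b`.** [cite: HatcherAT2002, §3.2 p. 210] -/
theorem totalPullback_slice_totalCross_one (ι : C(Z, P)) (hq : q.comp ι = ContinuousMap.id Z)
    (b : totalCohomology R Z) :
    totalPullback R ι (totalCross R p q (ofDegree R Y 0 (singularCohomology.one R Y) ⊗ₜ[R] b)) = b := by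
  rw [totalCross_one_tmul, ← LinearMap.comp_apply, ← totalPullback_comp, hq, totalPullback_id, LinearMap.id_apply]

/-- **Slice `ι : Z → P`: `ι^*((c • 1) × b) = c • b`.** [cite: HatcherAT2002, §3.2 p. 210] -/
theorem totalPullback_slice_totalCross_zero (ι : C(Z, P)) (hq : q.comp ι = ContinuousMap.id Z) (c : R)
    (b : totalCohomology R Z) :
    totalPullback R ι (totalCross R p q (ofDegree R Y 0 (c • singularCohomology.one R Y) ⊗ₜ[R] b)) = c • b := by
  rw [map_smul, ← smul_tmul', map_smul, map_smul, totalPullback_slice_totalCross_one p q ι hq]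

/-- **Slice `ι' : Y → P` with `q ∘ ι'` constant: positive degrees of `Z` die.** [cite: HatcherAT2002, §3.2 p. 210] -/
theorem totalPullback_slice'_totalCross_of_ne_zero (ι' : C(Y, P)) (z₀ : Z)
    (hq : q.comp ι' = ContinuousMap.const Y z₀) (a : totalCohomology R Y) {j : ℕ} (hj : j ≠ 0)
    (b : singularCohomology R R Z j) :
    totalPullback R ι' (totalCross R p q (a ⊗ₜ[R] ofDegree R Z j b)) = 0 := by
  have hb : totalPullback R ι' (totalPullback R q (ofDegree R Z j b)) = 0 := by
    rw [← LinearMap.comp_apply, ← totalPullback_comp, hq, totalPullback_lof, singularCohomology_map_const hj,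
      map_zero]
  rw [totalCross_tmul, totalPullback_totalCup, hb, map_zero]

/-- **Slice `ι' : Y → P` with `p ∘ ι' = id`: `ι'^*(a × 1) = a`.** [cite: HatcherAT2002, §3.2 p. 210] -/
theorem totalPullback_slice'_totalCross_one (ι' : C(Y, P)) (hp : p.comp ι' = ContinuousMap.id Y)
    (a : totalCohomology R Y) :
    totalPullback R ι' (totalCross R p q (a ⊗ₜ[R] ofDegree R Z 0 (singularCohomology.one R Z))) = a := by
  rw [totalCross_tmul_one, ← LinearMap.comp_apply, ← totalPullback_comp, hp, totalPullback_id, LinearMap.id_apply]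

/-- **Slice `ι' : Y → P`: `ι'^*(a × (c • 1)) = c • a`.** [cite: HatcherAT2002, §3.2 p. 210] -/
theorem totalPullback_slice'_totalCross_zero (ι' : C(Y, P)) (hp : p.comp ι' = ContinuousMap.id Y)
    (a : totalCohomology R Y) (c : R) :
    totalPullback R ι' (totalCross R p q (a ⊗ₜ[R] ofDegree R Z 0 (c • singularCohomology.one R Z))) = c • a := by
  rw [map_smul, tmul_smul, map_smul, map_smul, totalPullback_slice'_totalCross_one p q ι' hp]

end Literature.AlgebraicGeometry.Hyperkaehler

end
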